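import Summits.KontsevichZagierPeriods.KontsevichZagierPeriods.Theses.FermatIsogeny
import Summits.KontsevichZagierPeriods.KontsevichZagierPeriods.Theorems.TerasomaMultiplicationBetaCancellationStubIntegrateOut
import Literature.NumberTheory.Transcendental.KZDirichletCharts
import Literature.NumberTheory.Transcendental.KZCubeProducts
import Literature.NumberTheory.Transcendental.KZProductIdeal

/-!
# `DirichletNinth` (stmt-KontsevichZagierPeriods-3899) — Dirichlet re-association at `(1/9, 4/9, 8/9)`

Route `FermatIsogeny`, support item TRI(ii): for every representation
`r = [(0,1)², x^{-8/9}(1-x)^{-5/9} · y^{-1/9}(1-y)^{-4/9}]` (value `B(1/9,4/9)·B(8/9,5/9)`) and every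
`r' = [(0,1), (9/4) x^{-8/9}(1-x)^{-1/9}]` (value `(9/4)·B(1/9,8/9)`), `KZ.Equivalent r r'` — the value
identity `B(1/9,4/9)·B(8/9,5/9) = Γ(1/9)Γ(4/9)Γ(8/9)/Γ(13/9) = (9/4)·B(1/9,8/9)` realised INSIDE the
Kontsevich–Zagier calculus of moves (no Γ-function identity is used).

The chain (every representation pinned by domain and integrand; all of them exist, with absolutely
convergent integrands of exponents `> -1`):

1. swap the two coordinates (rule 2, `KZ.of_sub_of_reindex_mem_relations`), then reflect each
   coordinate `t ↦ 1 - t` (rule 2 twice, `KZ.of_sub_of_mem_relations_of_boxReflection`):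
   `r ∼ P = [(0,1)², u^{5/9-1}(1-u)^{8/9-1} · v^{4/9-1}(1-v)^{1/9-1}]`;
2. the polar Dirichlet chart `(u,v) ↦ (uv, u(1-v))` (rule 2, `KZ.dirichletPolar_equivalent` at
   `(a,b,c) = (4/9,1/9,8/9)`): `P ∼ S = [Δ, x^{4/9-1} y^{1/9-1} (1-x-y)^{8/9-1}]`;
3. the linear Dirichlet chart `(t,u) ↦ (u, (1-u)t)` (rule 2, `KZ.dirichletLinear_equivalent`):
   `S ∼ B' = [(0,1)², t^{1/9-1}(1-t)^{8/9-1} · u^{4/9-1}(1-u)^{0}]`;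
4. integrating out `u^{4/9-1}` along the last coordinate (rule 3 + rule 1 for the null faces,
   `stub_integrateOut` of `Theorems/TerasomaMultiplicationBetaCancellationStubIntegrateOut` at
   `(ℓ, m) = (4/9, 1/9)`): `B' ∼ r'`.

Sorry-free; axioms ⊆ {propext, Classical.choice, Quot.sound}; no definitions.

References: G. Andrews, R. Askey, R. Roy, *Special Functions* (1999), Thm 1.8.1 (Dirichlet's
integral); M. Kontsevich, D. Zagier, *Periods* (2001), §1.2.
-/

noncomputable section

-- Summit.KontsevichZagierPeriods.KontsevichZagierPeriods.… is the tree's mandated layout (single-conjunct summit).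
set_option linter.dupNamespace false

open MeasureTheory Set
open Literature.NumberTheory.Transcendental
open Literature.NumberTheory.Transcendental.KZ
open Summit.KontsevichZagierPeriods.KontsevichZagierPeriods.BetaCancellationLine (stub_integrateOut)

namespace Summit.KontsevichZagierPeriods.KontsevichZagierPeriods.Theorems

namespace DirichletNinth

/-- The two spellings of the open box `(0,1)² ⊆ ℝ²` agree. [folklore] -/
theorem box_forall_eq_and :
    {x : Fin 2 → ℝ | ∀ i, x i ∈ Set.Ioo (0:ℝ) 1} =
      {z : Fin 2 → ℝ | z 0 ∈ Set.Ioo (0:ℝ) 1 ∧ z 1 ∈ Set.Ioo (0:ℝ) 1} := by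
  ext x
  simp only [mem_setOf_eq, Fin.forall_fin_two]

/-- A representation on the open box `(0,1)²` with a PRESCRIBED integrand `g` exists as soon as `g`
agrees on the box with a cube Beta integrand `∏_j t_j^{x_j-1}(1-t_j)^{y_j-1}` of positive rational
data (`KZ.isSemialgebraicFunOn_cubeBetaIntegrand`, `KZ.integrableOn_cubeBetaIntegrand`).
[cite: KontsevichZagier2001, §1.1] -/
theorem exists_boxRep_of_eqOn (x y : Fin 2 → ℚ) (hpos : ∀ j, 0 < x j ∧ 0 < y j)
    (g : (Fin 2 → ℝ) → ℝ)
    (hg : Set.EqOn (fun t : Fin 2 → ℝ => ∏ j, (t j) ^ ((x j : ℝ) - 1) * (1 - t j) ^ ((y j : ℝ) - 1)) g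
      {t : Fin 2 → ℝ | ∀ j, t j ∈ Set.Ioo (0:ℝ) 1}) :
    ∃ ρ : IntegralRep 2, ρ.domain = {t : Fin 2 → ℝ | ∀ j, t j ∈ Set.Ioo (0:ℝ) 1} ∧ ρ.integrand = g :=
  ⟨⟨_, g, isSemialgebraic_box 2, (isSemialgebraicFunOn_cubeBetaIntegrand x y).congr hg,
    (integrableOn_cubeBetaIntegrand x y hpos).congr_fun hg
      (measurableSet_setOf_forall_apply_mem_Ioo 2)⟩, rfl, rfl⟩

end DirichletNinth

open DirichletNinth

/-- **`DirichletNinth`** (route `FermatIsogeny`, item stmt-KontsevichZagierPeriods-3899): Dirichlet's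
re-association `B(1/9,4/9)·B(8/9,5/9) = (9/4)·B(1/9,8/9)` as a chain of Kontsevich–Zagier moves —
for every `r = [(0,1)², x^{-8/9}(1-x)^{-5/9} y^{-1/9}(1-y)^{-4/9}]` and every
`r' = [(0,1), (9/4) x^{-8/9}(1-x)^{-1/9}]`, `r ∼ r'`: coordinate swap and two reflections (rule 2),
the polar and the linear Dirichlet charts through the open simplex (rule 2 twice,
`B(a+b,c)B(a,b) = B(b,c)B(a,b+c)` at `(a,b,c) = (4/9,1/9,8/9)`, where `b + c = 1` kills one power),
and one Newton–Leibniz move integrating out `u^{-5/9}` (rule 3, with the two null faces by rule 1).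
[cite: AndrewsAskeyRoy1999, Thm 1.8.1] -/
theorem dirichletNinth_proof :
    Summit.KontsevichZagierPeriods.KontsevichZagierPeriods.Theses.FermatIsogeny.DirichletNinth := by
  intro r r' hrd hri hr'd hr'i
  -- exponent bookkeeping (casts of the rational parameters)
  have e49 : ((4/9:ℚ):ℝ) - 1 = -(5:ℝ)/9 := by push_cast; norm_num
  have e19 : ((1/9:ℚ):ℝ) - 1 = -(8:ℝ)/9 := by push_cast; norm_num
  have e89 : ((8/9:ℚ):ℝ) - 1 = -(1:ℝ)/9 := by push_cast; norm_num
  have e59 : ((5/9:ℚ):ℝ) - 1 = -(4:ℝ)/9 := by push_cast; norm_num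
  have e4919 : ((4/9:ℚ):ℝ) + ((1/9:ℚ):ℝ) - 1 = -(4:ℝ)/9 := by push_cast; norm_num
  have e1989 : ((1/9:ℚ):ℝ) + ((8/9:ℚ):ℝ) - 1 = 0 := by push_cast; norm_num
  have e11 : ((1:ℚ):ℝ) - 1 = 0 := by push_cast; norm_num
  have e89' : ((8/9:ℚ):ℝ) - 1 = -((1/9:ℚ):ℝ) := by push_cast; norm_num
  have einv : ((4/9:ℚ):ℝ)⁻¹ = 9/4 := by push_cast; norm_num
  have eneg : -((1/9:ℚ):ℝ) = -(1:ℝ)/9 := by push_cast; norm_num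
  -- Step 1a: swap the coordinates (a reindexing move)
  set e : Fin 2 ≃ Fin 2 := Equiv.swap (0 : Fin 2) 1 with he
  have he0 : e 0 = 1 := by rw [he, Equiv.swap_apply_left]
  have he1 : e 1 = 0 := by rw [he, Equiv.swap_apply_right]
  have h1 : of r - of (r.reindex e) ∈ relations := of_sub_of_reindex_mem_relations r e
  -- Step 1b: reflect the coordinate `0`
  obtain ⟨r₂, hr₂d, hr₂i⟩ := exists_boxRep_of_eqOn ![5/9, 1/9] ![8/9, 4/9]
    (fun j => by fin_cases j <;> norm_num)
    (fun z => (z 1) ^ (-(8:ℝ)/9) * (1 - z 1) ^ (-(5:ℝ)/9) * (1 - z 0) ^ (-(1:ℝ)/9) *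
      (z 0) ^ (-(4:ℝ)/9))
    (fun z _ => by
      simp only [Fin.prod_univ_two, Matrix.cons_val_zero, Matrix.cons_val_one]
      rw [e59, e89, e19, e49]
      ring)
  have h2 : of r₂ - of (r.reindex e) ∈ relations := by
    refine of_sub_of_mem_relations_of_boxReflection 0 ?_ fun z hz => ?_
    · rw [hr₂d, IntegralRep.reindex_domain, hrd]
      ext z
      simp only [mem_setOf_eq, mem_preimage, Fin.forall_fin_two, he0, he1,
        boxReflection_apply_self, mem_Ioo,
        boxReflection_apply_of_ne (show (1 : Fin 2) ≠ 0 from by decide)]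
      constructor
      · rintro ⟨⟨h0, h0'⟩, h1, h1'⟩
        exact ⟨⟨h1, h1'⟩, by linarith, by linarith⟩
      · rintro ⟨⟨h1, h1'⟩, h0, h0'⟩
        exact ⟨⟨by linarith, by linarith⟩, h1, h1'⟩
    · rw [hr₂d] at hz
      have hz' : ∀ i, z i ∈ Set.Ioo (0:ℝ) 1 := hz
      have hv : (fun i => boxReflection 0 z (e i)) ∈ r.domain := by
        rw [hrd]
        show ∀ i, boxReflection 0 z (e i) ∈ Set.Ioo (0:ℝ) 1
        refine Fin.forall_fin_two.mpr ⟨?_, ?_⟩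
        · rw [he0, boxReflection_apply_of_ne (show (1 : Fin 2) ≠ 0 from by decide)]
          exact hz' 1
        · rw [he1, boxReflection_apply_self]
          exact ⟨by linarith [(hz' 0).2], by linarith [(hz' 0).1]⟩
      rw [IntegralRep.reindex_integrand, hr₂i]
      dsimp only
      rw [hri hv]
      simp only [he0, he1, boxReflection_apply_self,
        boxReflection_apply_of_ne (show (1 : Fin 2) ≠ 0 from by decide), sub_sub_cancel]
  -- Step 1c: reflect the coordinate `1`; `P` is spelled as the source of the polar chart
  obtain ⟨P, hPd, hPi⟩ := exists_boxRep_of_eqOn ![5/9, 4/9] ![8/9, 1/9]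
    (fun j => by fin_cases j <;> norm_num)
    (fun z => (z 0) ^ (((4/9:ℚ):ℝ) + ((1/9:ℚ):ℝ) - 1) * (1 - z 0) ^ (((8/9:ℚ):ℝ) - 1) *
      ((z 1) ^ (((4/9:ℚ):ℝ) - 1) * (1 - z 1) ^ (((1/9:ℚ):ℝ) - 1)))
    (fun z _ => by
      simp only [Fin.prod_univ_two, Matrix.cons_val_zero, Matrix.cons_val_one]
      rw [e59, e4919])
  have h3 : of P - of r₂ ∈ relations := by
    refine of_sub_of_mem_relations_of_boxReflection 1 ?_ fun z hz => ?_
    · rw [hPd, hr₂d]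
      ext z
      simp only [mem_setOf_eq, mem_preimage, forall_boxReflection_mem_Ioo_iff]
    · rw [hPi, hr₂i]
      dsimp only
      rw [boxReflection_apply_self, boxReflection_apply_of_ne (show (0 : Fin 2) ≠ 1 from by decide),
        sub_sub_cancel, e4919, e89, e49, e19]
      ring
  -- Step 2: the polar Dirichlet chart onto the simplex
  obtain ⟨S, hSd, hSi, hPS⟩ := dirichletPolar_equivalent (4/9) (1/9) (8/9) P
    (by rw [hPd, box_forall_eq_and]) (fun z _ => by rw [hPi])
  -- Step 3: the linear Dirichlet chart back to the box
  obtain ⟨B', hB'd, hB'i⟩ := exists_boxRep_of_eqOn ![1/9, 4/9] ![8/9, 1]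
    (fun j => by fin_cases j <;> norm_num)
    (fun z => (z 0) ^ (((1/9:ℚ):ℝ) - 1) * (1 - z 0) ^ (((8/9:ℚ):ℝ) - 1) *
      ((z 1) ^ (((4/9:ℚ):ℝ) - 1) * (1 - z 1) ^ (((1/9:ℚ):ℝ) + ((8/9:ℚ):ℝ) - 1)))
    (fun z _ => by
      simp only [Fin.prod_univ_two, Matrix.cons_val_zero, Matrix.cons_val_one]
      rw [e1989, e11])
  have hSB : Equivalent S B' := dirichletLinear_equivalent (4/9) (1/9) (8/9) S B' hSd hSi
    (by rw [hB'd, box_forall_eq_and]) (fun z _ => by rw [hB'i])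
  -- Step 4: integrate out the last coordinate
  have hBr : Equivalent B' r' := by
    refine stub_integrateOut (4/9) (1/9) (by norm_num) (by norm_num) (by norm_num) B' r'
      (by rw [hB'd, box_forall_eq_and]) (fun z _ => ?_) hr'd (fun x hx => ?_)
    · rw [hB'i]
      dsimp only
      rw [e1989, Real.rpow_zero, mul_one, e89']
    · rw [hr'i hx, einv, e19, eneg]
      ring
  -- assembling the chain
  have eq1 : Equivalent r (r.reindex e) := h1
  have eq2 : Equivalent (r.reindex e) r₂ := Equivalent.symm h2
  have eq3 : Equivalent r₂ P := Equivalent.symm h3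
  exact ((((eq1.trans eq2).trans eq3).trans hPS).trans hSB).trans hBr

end Summit.KontsevichZagierPeriods.KontsevichZagierPeriods.Theorems

end
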